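import Summits.Ventures.HodgeRepro2.A2ModelConjugation
import Summits.Ventures.HodgeRepro2.A2LefschetzSplitting

/-!
# A2LefschetzConjugation — the Lefschetz operators, the contractions and the primitive part
commute with the complex conjugation of the model (for a real Kähler class)

Tier-4 annex of sub-claim A2 (seat p6, cell pub-hodge-repro2); §8(d): uses an L-value-free
non-vanishing device: NO.

With `conjA = swapA ∘ coeffConj` (row 132) the sl₂-package of rows 101–120 is «defined over ℝ»:

* the swap moves a contraction to the contraction by the swapped dual (`swapA_contr_dual`), the
  coefficient conjugation commutes with every contraction (`coeffConj_contr_dual`), so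
  `conjA (ι_{a_j^*} x) = ι_{a_{swap j}^*} (conjA x)` (`conjA_contr_dual`);
* the plane contraction is ANTI-invariant, `conjA ∘ Λ_p = −Λ_p ∘ conjA` (`conjA_lamAt`: the two
  contractions of the plane anticommute, as `E_p ↦ −E_p`), hence
  `conjA ∘ Λ_c = Λ_{−c̄} ∘ conjA` and `conjA ∘ L_c = L_{−c̄} ∘ conjA` (`conjA_lam`, `conjA_lef`);
* for a REAL Kähler class (`c̄_p = −c_p`, row 133) `conjA` commutes with `L` and `Λ`
  (`conjA_lef_of_imaginary`, `conjA_lam_of_imaginary`), preserves primitivity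
  (`lam_conjA_eq_zero_of_imaginary`) and commutes with the primitive part of row 115
  (`conjA_primPart_of_imaginary`): the Lefschetz decomposition is conjugation-stable.

What stays prose: the identification of the model's operators with those of `H^*(B, ℂ)`
(Voisin §6.2); not on the N1 chain.
-/

namespace Summit.Ventures.HodgeRepro2.A2LefschetzConjugation

open WeilPlanes WeilIntegral WeilCoproduct A2ModelDuality A2HardLefschetzOps A2HodgeSymmetry
  A2CoefficientConjugation A2ModelConjugation A2LefschetzSplitting A2HodgeBigrading

variable {ι : Type*} [DecidableEq ι] [Fintype ι]

omit [DecidableEq ι] [Fintype ι] in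
/-- The dual basis vector of `j` pulled back along the swap is the dual basis vector of `swap j`. -/
theorem dual_comp_swapV (j : Gen ι) : (dual j).comp swapV.toLinearMap = dual (swapGen j) := rfl

omit [Fintype ι] in
/-- The swap moves a contraction by `a_j^*` to the contraction by `a_{swap j}^*` (on monomials). -/
theorem swapA_contr_dual_mono (j : Gen ι) (l : List (Gen ι)) :
    swapA (contr (dual j) (mono l)) = contr (dual (swapGen j)) (swapA (mono l)) := by
  induction l with
  | nil =>
    have h1 : mono ([] : List (Gen ι)) = 1 := by simp [mono]
    have hc1 : ∀ d : Module.Dual ℂ (V ι), contr d (1 : A ι) = 0 := fun d => by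
      rw [← (algebraMap ℂ (A ι)).map_one, A2HardLefschetzOps.contr_algebraMap]
    rw [h1, map_one swapA, hc1, hc1, map_zero]
  | cons k l ih =>
    have h1 : mono (k :: l) = gen k * mono l := by simp [mono]
    rw [h1, contr_dual_gen_mul, map_sub, map_mul, swapA_gen, ih, map_mul, swapA_gen,
      contr_dual_gen_mul]
    congr 1
    by_cases hjk : j = k
    · subst hjk
      rw [if_pos rfl, if_pos rfl]
    · rw [if_neg hjk, if_neg (fun h => hjk (swapGen.injective h)), map_zero]

/-- `swapA (ι_{a_j^*} x) = ι_{a_{swap j}^*} (swapA x)`. -/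
theorem swapA_contr_dual (j : Gen ι) (x : A ι) :
    swapA (contr (dual j) x) = contr (dual (swapGen j)) (swapA x) := by
  have h : (swapA.toLinearMap ∘ₗ contr (dual j) : A ι →ₗ[ℂ] A ι) =
      contr (dual (swapGen j)) ∘ₗ swapA.toLinearMap := by
    refine aBasis.ext fun s => ?_
    simp only [LinearMap.comp_apply, AlgHom.toLinearMap_apply]
    rw [aBasis_apply]
    exact swapA_contr_dual_mono j _
  have := LinearMap.congr_fun h x
  simpa only [LinearMap.comp_apply, AlgHom.toLinearMap_apply] using this

/-- The coefficient conjugation commutes with every contraction `ι_{a_j^*}` (its matrix on the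
monomial basis has entries `0, ±1`). -/
theorem coeffConj_contr_dual (j : Gen ι) (x : A ι) :
    coeffConj (contr (dual j) x) = contr (dual j) (coeffConj x) := by
  have h : (coeffConj.comp (contr (dual j)) : A ι →ₛₗ[starRingEnd ℂ] A ι) =
      (contr (dual j)).comp coeffConj := by
    refine aBasis.ext fun s => ?_
    simp only [LinearMap.comp_apply]
    rw [coeffConj_aBasis, aBasis_apply]
    by_cases hj : j ∈ genListOf s
    · obtain ⟨ε, hε, h⟩ := contr_dual_mono_of_mem (A2LamAdjoint.genListOf_nodup s) hj
      obtain ⟨ε', hε', h'⟩ := exists_sign_mono_eq_aBasis ((A2LamAdjoint.genListOf_nodup s).erase j)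
      rw [h, h', smul_smul, coeffConj_sign_smul_aBasis]
      rcases hε with rfl | rfl <;> rcases hε' with rfl | rfl <;> simp
    · rw [contr_dual_mono_of_notMem hj, map_zero]
  have := LinearMap.congr_fun h x
  simpa only [LinearMap.comp_apply] using this

/-- `conjA (ι_{a_j^*} x) = ι_{a_{swap j}^*} (conjA x)`. -/
theorem conjA_contr_dual (j : Gen ι) (x : A ι) :
    conjA (contr (dual j) x) = contr (dual (swapGen j)) (conjA x) := by
  rw [conjA_apply, conjA_apply, coeffConj_contr_dual, swapA_contr_dual]

/-- THE PLANE CONTRACTION IS ANTI-INVARIANT: `conjA (Λ_p x) = −Λ_p (conjA x)` — the two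
contractions of the plane anticommute (`contractLeft_comm`), as `E_p ↦ −E_p`. -/
theorem conjA_lamAt (p : ι) (x : A ι) : conjA (lamAt p x) = -(lamAt p (conjA x)) := by
  show conjA (contr (dual (p, true)) (contr (dual (p, false)) x)) =
    -(contr (dual (p, true)) (contr (dual (p, false)) (conjA x)))
  rw [conjA_contr_dual, conjA_contr_dual, swapGen_apply, swapGen_apply, Bool.not_true,
    Bool.not_false]
  exact CliffordAlgebra.contractLeft_comm _ _ _

/-- `conjA ∘ Λ_c = Λ_{−c̄} ∘ conjA`. -/
theorem conjA_lam (c : ι → ℂ) (x : A ι) :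
    conjA (lam c x) = lam (fun p => -((starRingEnd ℂ) (c p))) (conjA x) := by
  simp only [lam, LinearMap.sum_apply, LinearMap.smul_apply, map_sum, conjA_smul, conjA_lamAt,
    map_inv₀, inv_neg, neg_smul, smul_neg]

/-- `conjA ∘ L_c = L_{−c̄} ∘ conjA`. -/
theorem conjA_lef (c : ι → ℂ) (x : A ι) :
    conjA (lef c x) = lef (fun p => -((starRingEnd ℂ) (c p))) (conjA x) := by
  show conjA (theta c * x) = theta (fun p => -((starRingEnd ℂ) (c p))) * conjA x
  rw [conjA_mul, conjA_theta]
  congr 1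
  simp only [theta, neg_smul, Finset.sum_neg_distrib]

/-- For a real Kähler class (purely imaginary coordinates) `conjA` commutes with `Λ`. -/
theorem conjA_lam_of_imaginary {c : ι → ℂ} (hc : ∀ p, (starRingEnd ℂ) (c p) = -c p) (x : A ι) :
    conjA (lam c x) = lam c (conjA x) := by
  rw [conjA_lam]
  congr 2
  funext p
  rw [hc, neg_neg]

/-- For a real Kähler class `conjA` commutes with `L`. -/
theorem conjA_lef_of_imaginary {c : ι → ℂ} (hc : ∀ p, (starRingEnd ℂ) (c p) = -c p) (x : A ι) :
    conjA (lef c x) = lef c (conjA x) := by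
  rw [conjA_lef]
  congr 2
  funext p
  rw [hc, neg_neg]

/-- For a real Kähler class the conjugate of a primitive class is primitive. -/
theorem lam_conjA_eq_zero_of_imaginary {c : ι → ℂ} (hc : ∀ p, (starRingEnd ℂ) (c p) = -c p)
    {v : A ι} (hv : lam c v = 0) : lam c (conjA v) = 0 := by
  rw [← conjA_lam_of_imaginary hc, hv, map_zero]

/-- `θ_c` is real for purely imaginary coordinates (row 133's `conjA_theta_of_imaginary`, restated
here to keep the import list short). -/
theorem conjA_theta_of_imaginary' {c : ι → ℂ} (hc : ∀ p, (starRingEnd ℂ) (c p) = -c p) :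
    conjA (theta c) = theta c := by
  rw [conjA_theta]
  simp only [theta, hc, neg_smul, Finset.sum_neg_distrib, neg_neg]

/-- THE PRIMITIVE PART IS CONJUGATION-EQUIVARIANT for a real Kähler class:
`conjA (primPart x) = primPart (conjA x)` (row 115's splitting is unique). -/
theorem conjA_primPart_of_imaginary (c : ι → ℂ) (hc : ∀ p, c p ≠ 0)
    (hci : ∀ p, (starRingEnd ℂ) (c p) = -c p) {k : ℕ} (hk : k ≤ Fintype.card ι) {x : A ι}
    (hx : x ∈ grading ι k) :
    conjA (primPart c hc hk hx) = primPart c hc hk (conjA_mem_grading hx) := by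
  by_cases h2 : 2 ≤ k
  · refine primPart_eq_of_eq c hc h2 hk (conjA_mem_grading hx)
      (lam_conjA_eq_zero_of_imaginary hci (lam_primPart c hc hk hx))
      (conjA_mem_grading (lefPart_mem c hc hk hx)) ?_
    conv_lhs => rw [primPart_add_lef_lefPart c hc hk hx]
    rw [map_add, conjA_mul, conjA_theta_of_imaginary' hci]
    rfl
  · have hk2 : k < 2 := by omega
    simp only [primPart, if_pos hk2]

end Summit.Ventures.HodgeRepro2.A2LefschetzConjugation
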